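import Summits.CriticalPhenomena.PercolationContinuityZ3.Theorems.Transplant.SkelFrmBParamsReachFC
import Summits.CriticalPhenomena.PercolationContinuityZ3.Theorems.Transplant.SkelNegBParamsReachFC
import Summits.CriticalPhenomena.PercolationContinuityZ3.Theorems.Transplant.SkelFrm1SlotTypes
import Summits.CriticalPhenomena.PercolationContinuityZ3.Theorems.Transplant.SkelFrm1ParamsPO
import Summits.CriticalPhenomena.PercolationContinuityZ3.Theorems.Transplant.SkelFrm1ParamsLBL
import Summits.CriticalPhenomena.PercolationContinuityZ3.Theorems.Transplant.SkelFrmBParamsKitA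
import Summits.CriticalPhenomena.PercolationContinuityZ3.Theorems.Transplant.SkelFrmBParamsKitS
import Summits.CriticalPhenomena.PercolationContinuityZ3.Theorems.Transplant.SkelFrm1ParamsLF
import Summits.CriticalPhenomena.PercolationContinuityZ3.Theorems.Transplant.SkelFrm1ParamsLO
import Summits.CriticalPhenomena.PercolationContinuityZ3.Theorems.Transplant.SkelFrmBParamsLF
import Summits.CriticalPhenomena.PercolationContinuityZ3.Theorems.Transplant.SkelFrmBParamsFineSize
import Summits.CriticalPhenomena.PercolationContinuityZ3.Theorems.Transplant.SkelFrmBParamsLO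
import Summits.CriticalPhenomena.PercolationContinuityZ3.Theorems.Transplant.SkelFrmBParamsB
import Summits.CriticalPhenomena.PercolationContinuityZ3.Theorems.Transplant.SkelFrmBParamsSlotsR
import Summits.CriticalPhenomena.PercolationContinuityZ3.Theorems.Transplant.SkelFrmBParamsSlotsRS
import Summits.CriticalPhenomena.PercolationContinuityZ3.Theorems.Transplant.SkelFrmBParamsSlots
import Summits.CriticalPhenomena.PercolationContinuityZ3.Theorems.Transplant.SkelFrmBParamsSched
import Summits.CriticalPhenomena.PercolationContinuityZ3.Theorems.Transplant.SkelNegBParamsSlotsT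
import Summits.CriticalPhenomena.PercolationContinuityZ3.Theorems.Transplant.PlanarSkeletonFrmDefs
import Summits.CriticalPhenomena.PercolationContinuityZ3.Theorems.Transplant.SkelPhiStepIDataNS
import HarnessLib

/-!
# N2 (frames-only node `SamePDropOfSkeletonFrm₁`, OPEN) params column over `PlanarSkeletonFrm` — (ζ″) ledger, shape (B′) of record ((R-14)):
# MECHANICAL PORT of N1's `SkelNegBParamsSlotsT` — chain of record `NegB`, part SlotsT: THE BOX AND WIDTH SLOT VALUES OF RECORD WITH FUNCTION-VALUED RESIDUAL SLOTS
# (supersedes part Slots' `KS.gR/fR`, whose residuals `gx fx : ℕ` were constants and cannot carry the p-fixed floors posted 2026-08-21T18:30:46Z by p5-g9) — **`KS.gT mk (gx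
# : Neg.FSlot) : … (N1 title abridged; see `SkelNegBParamsSlotsT`)
builds on p205010 (kernel theorem, internal audit signed; external expert review pending) — nothing in this file uses p205010; NOTHING is claimed about the
open node `SamePDropOfSkeletonFrm₁` (`SamePDropOfSkeletonNeg₁` is CLOSED in the tree and untouched by this file).
Status sentence (coordinator 2026-08-20T04:30Z): "θ(p_c) = 0 on ℤ^d, all d ≥ 2 — kernel-verified (Lean 4/Mathlib, standard axioms); internal adversarial
audit SIGNED 2026-08-20 04:29Z; external expert review pending."
Lane `prim-bschramm-*`, seat `prim-bschramm-stmt` (gen 19); helper file (`--supports stmt-CriticalPhenomena-4575 --as helper`); ledger HOME/prim-bschramm-stmt/FRM-PARAMS.md §9, (R-14).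
PORT RULES (HOME/prim-bschramm-stmt-g19/lean/port_frm.py, the tool of record per (R-14)): outer namespace `PlanarSkeletonNeg ↦ PlanarSkeletonFrm`, carrier binder
`(Φ : PlanarSkeletonFrm G)`, record binder `(D : Skelφ.StepI.DataNS V)` (the selectors travel IN the record, `SkelPhiStepIDataNS`); section variables INLINED into every
declaration header; inner namespaces (`Neg`/`NegB`/`KS`/…) and every short name KEPT so all cross-references resolve unchanged; declarations using no section variable are
NOT re-declared (N1's originals are referenced fully qualified). Mathematical content, proofs, docstrings and citations are N1's, verbatim, except where stated next.
SELECTORS IN THIS FILE ((R-14) condition of record — joint selection, `D.sN`'s first argument is the literal handed to `D.sM`): none (pure port; the pairs are read through their N1 names).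
N1 HEADER (kept for the reader):
helper file (`--supports stmt-CriticalPhenomena-4575 --as helper`); ledger HOME/prim-bschramm-stmt/NEG-PARAMS.md v0.13.
HOW TO INSTANTIATE: `negChoiceAllOS (KS.gT mk gx) (KS.fT mk fx) (KS.PR mk Px) Sv` (or the `…OT` choice function of part ChoiceAllT once the arrival box is re-ruled), with `mk := 0`,
`gx fx := Neg.FSlot.zero`, `Px := PSlot.empty` unless a residue posts a further floor (then `gx := fun … D => <expr>`); at `(O, q)` the values are `KS.gT mk gx κ Φ t p O.merged` (rfl).
* §0 `Neg.FSlot.zero`; §1 `gT`, `gT_at`, `gT_floors`, **`ML_floorsT`** (`4K(RA'+2)`, `22000(RA'+2)`, `16(n_b+ℓ_b+|h_b|)`, `gx …`, `4K·RA'+2`, `RA'+2 ≤ M_L`), `ML_floorT_int`;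
* §2 `fT`, `fT_at`, `fT_floors`, **`nL_floorsT`** (`K(RA'+2)`, `2000(RA'+2)`, (R-F1), `fx …`, `RA'+2 ≤ n_L`, `M_u < n_L`, `n_b ≤ n_L`);
* §3 at `g := gT`: **`cells_geT`**, `r_geT` (via part Slots' `s_ge_of_floor`), **`layer_T`** (`(RA'+3)·(n_L+|h_L|) ≤ n_L ℓ_L + 1`, p5's (f1)), **`corridor_floors_T`** (p5's (f3):
  `2000(RA'+2) ≤ n_L` and `2000(RA'+2)·(n_L+|h_L|) ≤ n_L·ℓ_L − n_L`), `ℓL_ge_T` (`22000(RA'+2) + 1 ≤ ℓ_L`).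
[cite: KozmaNitzan2024, §4 Theorem 6 (pp. 25–31): the order of constants; Lemma 12 (pp. 23–25)] [cite: MartineauTassion2017, §3.2 Lemma 3.5]
-/

noncomputable section

open scoped Classical

namespace Summit.CriticalPhenomena.PercolationContinuityZ3.Theorems.Transplant

namespace PlanarSkeletonFrm

/-! ## §0 The zero residual -/

/-- **The zero width/box residual** (the value of `gx`/`fx` when no further floor is posted). [folklore] -/
def Neg.FSlot.zero  : Neg.FSlot := fun _ _ _ _ _ _ _ _ _ _ => 0

/-- `FSlot.zero` evaluates to `0`. [folklore] -/
theorem Neg.FSlot.zero_at  (κ : SkelConc.Consts) {V : Type} [DecidableEq V] [Countable V] {G : SimpleGraph V} [G.LocallyFinite] (Φ : PlanarSkeletonFrm G) (t : V)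
    (p : unitInterval) (D : Skelφ.StepI.DataNS V) : PlanarSkeletonFrm.Neg.FSlot.zero κ Φ t p D = 0 := rfl

namespace NegB

namespace KS

open MeasureTheory Literature.Probability.Percolation Literature.Probability.LatticeModels SimpleGraph
open SkelConc (Consts)
open Skelφ (oriφ trφ)
open Skelφ.StepI (DataN OutO)
open Neg

/-! ## §1 The box slot value -/

/-- **THE BOX FLOOR OF RECORD** (kit index slot `mk`, residual FUNCTION slot `gx`): `max {4K(RA'+2), 22000·(RA'+2), 16(n_b+ℓ_b+|h_b|), gx κ Φ t p D}`. [this work] -/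
def gT  (mk : ℕ) (gx : Neg.FSlot) : Neg.FSlot := fun κ _ _ _ _ _ Φ t p D =>
  max (max (max (4 * Neg.K κ * (RA' κ Φ t p D mk + 2)) (22000 * (RA' κ Φ t p D mk + 2))) (16 * (nBR κ Φ t p D mk + ℓBR κ Φ t p D mk + (hBR κ Φ t p D mk).natAbs)))
    (gx κ Φ t p D)

section Box

/-- `gT` at `(κ, Φ, t, p, D)` (by `rfl`). [folklore] -/
theorem gT_at (κ : Consts) {V : Type} [DecidableEq V] [Countable V] {G : SimpleGraph V} [G.LocallyFinite] (Φ : PlanarSkeletonFrm G) (t : V) (p : unitInterval) (D : Skelφ.StepI.DataNS V) (mk : ℕ) (gx : Neg.FSlot) : gT mk gx κ Φ t p D =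
    max (max (max (4 * Neg.K κ * (RA' κ Φ t p D mk + 2)) (22000 * (RA' κ Φ t p D mk + 2))) (16 * (nBR κ Φ t p D mk + ℓBR κ Φ t p D mk + (hBR κ Φ t p D mk).natAbs)))
      (gx κ Φ t p D) := rfl

/-- The four floors inside `gT`. [folklore] -/
theorem gT_floors (κ : Consts) {V : Type} [DecidableEq V] [Countable V] {G : SimpleGraph V} [G.LocallyFinite] (Φ : PlanarSkeletonFrm G) (t : V) (p : unitInterval) (D : Skelφ.StepI.DataNS V) (mk : ℕ) (gx : Neg.FSlot) : 4 * Neg.K κ * (RA' κ Φ t p D mk + 2) ≤ gT mk gx κ Φ t p D ∧ 22000 * (RA' κ Φ t p D mk + 2) ≤ gT mk gx κ Φ t p D ∧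
    16 * (nBR κ Φ t p D mk + ℓBR κ Φ t p D mk + (hBR κ Φ t p D mk).natAbs) ≤ gT mk gx κ Φ t p D ∧ gx κ Φ t p D ≤ gT mk gx κ Φ t p D := by
  refine ⟨?_, ?_, ?_, le_max_right _ _⟩ <;> rw [gT_at] <;> omega

/-- **THE LONG BOX's FLOORS AT `g := gT`**. [folklore] -/
theorem ML_floorsT (κ : Consts) {V : Type} [DecidableEq V] [Countable V] {G : SimpleGraph V} [G.LocallyFinite] (Φ : PlanarSkeletonFrm G) (t : V) (p : unitInterval) (D : Skelφ.StepI.DataNS V) (mk : ℕ) (gx : Neg.FSlot) : 4 * Neg.K κ * (RA' κ Φ t p D mk + 2) ≤ ML κ Φ t p D (gT mk gx κ Φ t p D) ∧ 22000 * (RA' κ Φ t p D mk + 2) ≤ ML κ Φ t p D (gT mk gx κ Φ t p D) ∧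
    16 * (nBR κ Φ t p D mk + ℓBR κ Φ t p D mk + (hBR κ Φ t p D mk).natAbs) ≤ ML κ Φ t p D (gT mk gx κ Φ t p D) ∧
    gx κ Φ t p D ≤ ML κ Φ t p D (gT mk gx κ Φ t p D) ∧ 4 * Neg.K κ * RA' κ Φ t p D mk + 2 ≤ ML κ Φ t p D (gT mk gx κ Φ t p D) ∧
    RA' κ Φ t p D mk + 2 ≤ ML κ Φ t p D (gT mk gx κ Φ t p D) := by
  have hg := (ML_le_ML κ Φ t p D (gT mk gx κ Φ t p D)).2
  obtain ⟨h1, h2, h3, h4⟩ := gT_floors κ Φ t p D mk gx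
  have hK := (Neg.forty_le_K κ).1
  refine ⟨h1.trans hg, h2.trans hg, h3.trans hg, h4.trans hg, ?_, ?_⟩
  · have : 4 * Neg.K κ * RA' κ Φ t p D mk + 2 ≤ 4 * Neg.K κ * (RA' κ Φ t p D mk + 2) := by nlinarith
    exact this.trans (h1.trans hg)
  · have : RA' κ Φ t p D mk + 2 ≤ 22000 * (RA' κ Φ t p D mk + 2) := by omega
    exact this.trans (h2.trans hg)

/-- The ℤ forms `4K(RA'+2) ≤ M_L`, `22000(RA'+2) ≤ M_L`. [folklore] -/
theorem ML_floorT_int (κ : Consts) {V : Type} [DecidableEq V] [Countable V] {G : SimpleGraph V} [G.LocallyFinite] (Φ : PlanarSkeletonFrm G) (t : V) (p : unitInterval) (D : Skelφ.StepI.DataNS V) (mk : ℕ) (gx : Neg.FSlot) : 4 * (Neg.K κ : ℤ) * ((RA' κ Φ t p D mk : ℤ) + 2) ≤ (ML κ Φ t p D (gT mk gx κ Φ t p D) : ℤ) ∧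
    22000 * ((RA' κ Φ t p D mk : ℤ) + 2) ≤ (ML κ Φ t p D (gT mk gx κ Φ t p D) : ℤ) := by
  obtain ⟨h1, h2, -⟩ := ML_floorsT κ Φ t p D mk gx
  exact ⟨by exact_mod_cast h1, by exact_mod_cast h2⟩

end Box

/-! ## §2 The width slot value -/

/-- **THE WIDTH FLOOR OF RECORD** (residual FUNCTION slot `fx`): `max {K(RA'+2), 2000·(RA'+2), D.k + RA' + pgScale n_b h_b (3ℓ_b) + 1, fx κ Φ t p D}`. [this work] -/
def fT  (mk : ℕ) (fx : Neg.FSlot) : Neg.FSlot := fun κ _ _ _ _ _ Φ t p D =>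
  max (max (max (Neg.K κ * (RA' κ Φ t p D mk + 2)) (2000 * (RA' κ Φ t p D mk + 2)))
    (D.k + RA' κ Φ t p D mk + Skelφ.pgScale (nBR κ Φ t p D mk) (hBR κ Φ t p D mk) (3 * ℓBR κ Φ t p D mk) + 1)) (fx κ Φ t p D)

section Width

/-- `fT` at `(κ, Φ, t, p, D)` (by `rfl`). [folklore] -/
theorem fT_at (κ : Consts) {V : Type} [DecidableEq V] [Countable V] {G : SimpleGraph V} [G.LocallyFinite] (Φ : PlanarSkeletonFrm G) (t : V) (p : unitInterval) (D : Skelφ.StepI.DataNS V) (mk : ℕ) (fx : Neg.FSlot) : fT mk fx κ Φ t p D =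
    max (max (max (Neg.K κ * (RA' κ Φ t p D mk + 2)) (2000 * (RA' κ Φ t p D mk + 2)))
      (D.k + RA' κ Φ t p D mk + Skelφ.pgScale (nBR κ Φ t p D mk) (hBR κ Φ t p D mk) (3 * ℓBR κ Φ t p D mk) + 1)) (fx κ Φ t p D) := rfl

/-- The four floors inside `fT`. [folklore] -/
theorem fT_floors (κ : Consts) {V : Type} [DecidableEq V] [Countable V] {G : SimpleGraph V} [G.LocallyFinite] (Φ : PlanarSkeletonFrm G) (t : V) (p : unitInterval) (D : Skelφ.StepI.DataNS V) (mk : ℕ) (fx : Neg.FSlot) : Neg.K κ * (RA' κ Φ t p D mk + 2) ≤ fT mk fx κ Φ t p D ∧ 2000 * (RA' κ Φ t p D mk + 2) ≤ fT mk fx κ Φ t p D ∧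
    D.k + RA' κ Φ t p D mk + Skelφ.pgScale (nBR κ Φ t p D mk) (hBR κ Φ t p D mk) (3 * ℓBR κ Φ t p D mk) + 1 ≤ fT mk fx κ Φ t p D ∧ fx κ Φ t p D ≤ fT mk fx κ Φ t p D := by
  refine ⟨?_, ?_, ?_, le_max_right _ _⟩ <;> rw [fT_at] <;> omega

/-- **THE LONG WIDTH's FLOORS AT `f := fT`** (any box value `g`). [folklore] -/
theorem nL_floorsT (κ : Consts) {V : Type} [DecidableEq V] [Countable V] {G : SimpleGraph V} [G.LocallyFinite] (Φ : PlanarSkeletonFrm G) (t : V) (p : unitInterval) (D : Skelφ.StepI.DataNS V) (mk : ℕ) (fx : Neg.FSlot) (g : ℕ) : Neg.K κ * (RA' κ Φ t p D mk + 2) ≤ nL κ Φ t p D g (fT mk fx κ Φ t p D) ∧ 2000 * (RA' κ Φ t p D mk + 2) ≤ nL κ Φ t p D g (fT mk fx κ Φ t p D) ∧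
    D.k + RA' κ Φ t p D mk + Skelφ.pgScale (nBR κ Φ t p D mk) (hBR κ Φ t p D mk) (3 * ℓBR κ Φ t p D mk) + 1 ≤ nL κ Φ t p D g (fT mk fx κ Φ t p D) ∧
    fx κ Φ t p D ≤ nL κ Φ t p D g (fT mk fx κ Φ t p D) ∧ RA' κ Φ t p D mk + 2 ≤ nL κ Φ t p D g (fT mk fx κ Φ t p D) ∧ Mu D < nL κ Φ t p D g (fT mk fx κ Φ t p D) ∧
    nBR κ Φ t p D mk ≤ nL κ Φ t p D g (fT mk fx κ Φ t p D) := by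
  have hf := (n₁L_le_nL κ Φ t p D g (fT mk fx κ Φ t p D)).2
  obtain ⟨h1, h2, h3, h4⟩ := fT_floors κ Φ t p D mk fx
  have hMu : Mu D < nL κ Φ t p D g (fT mk fx κ Φ t p D) := lt_of_le_of_lt (Mu_le_ML κ Φ t p D g) (ML_lt_nL κ Φ t p D g _).1
  refine ⟨h1.trans hf, h2.trans hf, h3.trans hf, h4.trans hf, ?_, hMu, ?_⟩
  · have : RA' κ Φ t p D mk + 2 ≤ 2000 * (RA' κ Φ t p D mk + 2) := by omega
    exact this.trans (h2.trans hf)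
  · have : nBR κ Φ t p D mk ≤ Skelφ.pgScale (nBR κ Φ t p D mk) (hBR κ Φ t p D mk) (3 * ℓBR κ Φ t p D mk) := le_max_left _ _
    omega

/-- The ℤ form `2000(RA'+2) ≤ n_L`. [folklore] -/
theorem nL_floorT_int (κ : Consts) {V : Type} [DecidableEq V] [Countable V] {G : SimpleGraph V} [G.LocallyFinite] (Φ : PlanarSkeletonFrm G) (t : V) (p : unitInterval) (D : Skelφ.StepI.DataNS V) (mk : ℕ) (fx : Neg.FSlot) (g : ℕ) : 2000 * ((RA' κ Φ t p D mk : ℤ) + 2) ≤ (nL κ Φ t p D g (fT mk fx κ Φ t p D) : ℤ) := by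
  exact_mod_cast (nL_floorsT κ Φ t p D mk fx g).2.1

end Width

/-! ## §3 Cells, layer and the corridor floors at the values -/

section AtValues

/-- **THE CELLS AT `g := gT`**: `6·RA' + 11 ≤ s₀`, `14·RA' + 27 ≤ s₁` (any width `f`). [folklore] -/
theorem cells_geT (κ : Consts) {V : Type} [DecidableEq V] [Countable V] {G : SimpleGraph V} [G.LocallyFinite] (Φ : PlanarSkeletonFrm G) (t : V) (p : unitInterval) (D : Skelφ.StepI.DataNS V) (mk : ℕ) (gx : Neg.FSlot) (f : ℕ) (hN : EqNumL κ Φ t p D (gT mk gx κ Φ t p D) f) (hκ : (hL κ Φ t p D (gT mk gx κ Φ t p D) f).natAbs ≤ 10 * nL κ Φ t p D (gT mk gx κ Φ t p D) f) :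
    6 * (RA' κ Φ t p D mk : ℤ) + 11 ≤ (((fcells κ Φ t p D (gT mk gx κ Φ t p D) f).s 0 : ℕ) : ℤ) ∧
      14 * (RA' κ Φ t p D mk : ℤ) + 27 ≤ (((fcells κ Φ t p D (gT mk gx κ Φ t p D) f).s 1 : ℕ) : ℤ) :=
  s_ge_of_floor κ Φ t p D _ f hN hκ (ML_floorsT κ Φ t p D mk gx).1

/-- **The fine radii at `g := gT`**: `K·(6RA'+11) ≤ r₀`, `K·(14RA'+27) ≤ r₁`. [folklore] -/
theorem r_geT (κ : Consts) {V : Type} [DecidableEq V] [Countable V] {G : SimpleGraph V} [G.LocallyFinite] (Φ : PlanarSkeletonFrm G) (t : V) (p : unitInterval) (D : Skelφ.StepI.DataNS V) (mk : ℕ) (gx : Neg.FSlot) (f : ℕ) (hN : EqNumL κ Φ t p D (gT mk gx κ Φ t p D) f) (hκ : (hL κ Φ t p D (gT mk gx κ Φ t p D) f).natAbs ≤ 10 * nL κ Φ t p D (gT mk gx κ Φ t p D) f) :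
    (Neg.K κ : ℤ) * (6 * (RA' κ Φ t p D mk : ℤ) + 11) ≤ ((fcells κ Φ t p D (gT mk gx κ Φ t p D) f).r 0 : ℤ) ∧
      (Neg.K κ : ℤ) * (14 * (RA' κ Φ t p D mk : ℤ) + 27) ≤ ((fcells κ Φ t p D (gT mk gx κ Φ t p D) f).r 1 : ℤ) := by
  obtain ⟨h0, h1⟩ := cells_geT κ Φ t p D mk gx f hN hκ
  have hr := (fcells_K κ Φ t p D (gT mk gx κ Φ t p D) f).2.2
  have hK : (0 : ℤ) ≤ Neg.K κ := by positivity
  rw [hr 0, hr 1]; push_cast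
  exact ⟨by nlinarith, by nlinarith⟩

/-- **`22000·(RA'+2) + 1 ≤ ℓ_L`** at `g := gT` (from `M_L + 1 ≤ ℓ_L`). [folklore] -/
theorem ℓL_ge_T (κ : Consts) {V : Type} [DecidableEq V] [Countable V] {G : SimpleGraph V} [G.LocallyFinite] (Φ : PlanarSkeletonFrm G) (t : V) (p : unitInterval) (D : Skelφ.StepI.DataNS V) (mk : ℕ) (gx : Neg.FSlot) (f : ℕ) (hN : EqNumL κ Φ t p D (gT mk gx κ Φ t p D) f) : 22000 * ((RA' κ Φ t p D mk : ℤ) + 2) + 1 ≤ (ℓL κ Φ t p D (gT mk gx κ Φ t p D) f : ℤ) := by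
  have h1 := (ML_floorT_int κ Φ t p D mk gx).2
  have h2 := hN.ℓ_le
  linarith

/-- **THE v-ROUND SITING FLOOR, one notch stronger** (p5-g9 (f1): `(RA'+3)·U_L ≤ n_L ℓ_L + 1`) at `g := gT`, any `f`. [folklore] -/
theorem layer_T (κ : Consts) {V : Type} [DecidableEq V] [Countable V] {G : SimpleGraph V} [G.LocallyFinite] (Φ : PlanarSkeletonFrm G) (t : V) (p : unitInterval) (D : Skelφ.StepI.DataNS V) (mk : ℕ) (gx : Neg.FSlot) (f : ℕ) (hN : EqNumL κ Φ t p D (gT mk gx κ Φ t p D) f) (hκ : (hL κ Φ t p D (gT mk gx κ Φ t p D) f).natAbs ≤ 10 * nL κ Φ t p D (gT mk gx κ Φ t p D) f) :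
    ((RA' κ Φ t p D mk : ℤ) + 3) * ((nL κ Φ t p D (gT mk gx κ Φ t p D) f + (hL κ Φ t p D (gT mk gx κ Φ t p D) f).natAbs : ℕ) : ℤ) ≤
      (nL κ Φ t p D (gT mk gx κ Φ t p D) f : ℤ) * ℓL κ Φ t p D (gT mk gx κ Φ t p D) f + 1 := by
  have h1 := ℓL_ge_T κ Φ t p D mk gx f hN
  have hκ' : ((hL κ Φ t p D (gT mk gx κ Φ t p D) f).natAbs : ℤ) ≤ 10 * (nL κ Φ t p D (gT mk gx κ Φ t p D) f : ℤ) := by exact_mod_cast hκ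
  have hn : (0 : ℤ) ≤ nL κ Φ t p D (gT mk gx κ Φ t p D) f := by positivity
  have hR : (0 : ℤ) ≤ (RA' κ Φ t p D mk : ℤ) := by positivity
  push_cast
  nlinarith

/-- **p5-g9's CORRIDOR TARGET/ROOM FLOORS (f3)** at `(g, f) := (gT, fT)`: `2000·(RA'+2) ≤ n_L` and `2000·(RA'+2)·(n_L+|h_L|) ≤ n_L·ℓ_L − n_L`. [folklore] -/
theorem corridor_floors_T (κ : Consts) {V : Type} [DecidableEq V] [Countable V] {G : SimpleGraph V} [G.LocallyFinite] (Φ : PlanarSkeletonFrm G) (t : V) (p : unitInterval) (D : Skelφ.StepI.DataNS V) (mk : ℕ) (gx : Neg.FSlot) (fx : Neg.FSlot) (hN : EqNumL κ Φ t p D (gT mk gx κ Φ t p D) (fT mk fx κ Φ t p D))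
    (hκ : (hL κ Φ t p D (gT mk gx κ Φ t p D) (fT mk fx κ Φ t p D)).natAbs ≤ 10 * nL κ Φ t p D (gT mk gx κ Φ t p D) (fT mk fx κ Φ t p D)) :
    2000 * ((RA' κ Φ t p D mk : ℤ) + 2) ≤ (nL κ Φ t p D (gT mk gx κ Φ t p D) (fT mk fx κ Φ t p D) : ℤ) ∧
      2000 * ((RA' κ Φ t p D mk : ℤ) + 2) *
          ((nL κ Φ t p D (gT mk gx κ Φ t p D) (fT mk fx κ Φ t p D) + (hL κ Φ t p D (gT mk gx κ Φ t p D) (fT mk fx κ Φ t p D)).natAbs : ℕ) : ℤ) ≤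
        (nL κ Φ t p D (gT mk gx κ Φ t p D) (fT mk fx κ Φ t p D) : ℤ) * ℓL κ Φ t p D (gT mk gx κ Φ t p D) (fT mk fx κ Φ t p D) -
          nL κ Φ t p D (gT mk gx κ Φ t p D) (fT mk fx κ Φ t p D) := by
  have h0 := nL_floorT_int κ Φ t p D mk fx (gT mk gx κ Φ t p D)
  have h1 := ℓL_ge_T κ Φ t p D mk gx (fT mk fx κ Φ t p D) hN
  have hκ' : ((hL κ Φ t p D (gT mk gx κ Φ t p D) (fT mk fx κ Φ t p D)).natAbs : ℤ) ≤ 10 * (nL κ Φ t p D (gT mk gx κ Φ t p D) (fT mk fx κ Φ t p D) : ℤ) := by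
    exact_mod_cast hκ
  have hn : (0 : ℤ) ≤ nL κ Φ t p D (gT mk gx κ Φ t p D) (fT mk fx κ Φ t p D) := by positivity
  have hR : (0 : ℤ) ≤ (RA' κ Φ t p D mk : ℤ) := by positivity
  refine ⟨h0, ?_⟩
  push_cast
  nlinarith

end AtValues

end KS

end NegB

end PlanarSkeletonFrm

end Summit.CriticalPhenomena.PercolationContinuityZ3.Theorems.Transplant

end
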